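import Summits.ResolutionOfSingularities.ResolutionOfSingularities.Theorems.EquisingularLiftEquisingularLiftNatNDRoundModel
import Literature.AlgebraicGeometry.Resolution.AffineCoordinateBlowupCharts
import Literature.AlgebraicGeometry.Resolution.Hironaka2005AmbientReductionSchemeOfAffine
import Literature.AlgebraicGeometry.Resolution.CoordinateBlowupStrictTransformIdeal
import Literature.AlgebraicGeometry.Resolution.MarkedIdealsLemmas
import Literature.AlgebraicGeometry.Resolution.IdealSheafLemmas
import Mathlib.RingTheory.Polynomial.UniqueFactorization
import HarnessLib

/-!
# [OURS · L1 W4.5(b) · EL♮(3) · ND-K5 (B4α1)] THE AFFINE DICTIONARY FOR TORIC CHARTS: `idealSheafOf`, strict transforms along `Spec φ`, and the closure lemma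

WIDTH helper for the ND-K5 bricks (B4α1i) `modelInit` / (B4α1s) `modelStep` (res-L1-w45b-idea-1's spec §13.14 `ND.ToricStage`), `--supports
stmt-ResolutionOfSingularities-20148`, no claim, counted 0 (res-L1-w45b-stub-4 g11).  AI-produced kernel work weaker than expert review; no statement of
[Hironaka2017] is used; EL♮(3) is NOT proved here.

WHAT.  (1) `Hironaka2005.idealSheafOf` on `Spec R` is a ring-order dictionary: top ideal (`ideal_idealSheafOf_top`), extensionality
(`idealSheafOf_eq_of_ideal_top_eq`), powers, colons (`map_colon_of_ringEquiv`, `idealSheafOf_colon`, Noetherian `R`), suprema; hence **the strict transform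
along `Spec φ`** of `idealSheafOf J` w.r.t. the centre `idealSheafOf I` is `idealSheafOf (⨆ₙ (φJ : (φI)ⁿ))` (`strictTransformIdeal_specMap_idealSheafOf`), and
for the coordinate blow-up substitution `coordBlowupSubst S A i₀` it is `idealSheafOf (coordStrictTransformIdeal S A i₀ J)` (Literature
`CoordinateBlowupStrictTransformIdeal`; `mem_iSup_colon_span_singleton_pow`, `iSup_colon_eq_coordStrictTransformIdeal`,
`strictTransformIdeal_specMap_coordBlowupSubst`); the coordinate-subspace centre `AffineCoordBlowup.𝓘Λ = idealSheafOf IΛ` (`𝓘Λ_eq_idealSheafOf`).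
(2) **The closure lemma** in `Spec` of a UFD: a prime ideal containing `f ≠ 0` contains a prime factor of `f` (`exists_prime_dvd_mem_of_mem`), so for a
prime element `y ∤ f`, `closure (V(f) ∖ V(y)) = V(f)` (`closure_zeroLocus_diff_zeroLocus_of_not_dvd`) — the set-level strict transform of a hypersurface
in a chart whose exceptional equation does not divide the proper transform.
-/

set_option linter.dupNamespace false

noncomputable section

open CategoryTheory AlgebraicGeometry TopologicalSpace MvPolynomial
open Literature.AlgebraicGeometry.Resolution
open AlgebraicGeometry.Scheme.IdealSheafData

namespace Summit.ResolutionOfSingularities.ResolutionOfSingularities.Cruxes.EquisingularLiftNat.Sections.ND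

universe u v

/-! ## `idealSheafOf` is a ring-order dictionary on an affine space: top ideal, powers, colons, suprema -/

section Dict

variable {R : Type u} [CommRing R]

/-- The top ideal of `idealSheafOf J` is `J` transported along `Γ(Spec R, ⊤) ≅ R`. [folklore] -/
theorem ideal_idealSheafOf_top (J : Ideal R) :
    (Hironaka2005.idealSheafOf J).ideal ⟨⊤, isAffineOpen_top _⟩ = J.map (Scheme.ΓSpecIso (.of R)).inv.hom :=
  ideal_ofIdealTop_top _

/-- `idealSheafOf` is injective-friendly: two ideal sheaves on `Spec R` agree iff their top ideals do. [folklore] -/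
theorem idealSheafOf_eq_of_ideal_top_eq {I : (Spec (.of R)).IdealSheafData} {J : Ideal R}
    (h : I.ideal ⟨⊤, isAffineOpen_top _⟩ = J.map (Scheme.ΓSpecIso (.of R)).inv.hom) : I = Hironaka2005.idealSheafOf J :=
  Scheme.IdealSheafData.ext_of_isAffine (by rw [h, ideal_idealSheafOf_top])

/-- `idealSheafOf` respects powers. [folklore] -/
theorem idealSheafOf_pow (J : Ideal R) (n : ℕ) : Hironaka2005.idealSheafOf (J ^ n) = Hironaka2005.idealSheafOf J ^ n := by
  refine (idealSheafOf_eq_of_ideal_top_eq ?_).symm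
  rw [Scheme.IdealSheafData.ideal_pow, Pi.pow_apply, ideal_idealSheafOf_top, Ideal.map_pow]

/-- Colon ideals commute with ring isomorphisms. [folklore] -/
theorem map_colon_of_ringEquiv {S : Type*} [CommRing S] (e : R ≃+* S) (I J : Ideal R) :
    (I.colon (J : Set R)).map (e : R →+* S) = (I.map (e : R →+* S)).colon ((J.map (e : R →+* S) : Ideal S) : Set S) := by
  rw [Ideal.map_comap_of_equiv, Ideal.map_comap_of_equiv, Ideal.map_comap_of_equiv]
  ext g
  simp only [Ideal.mem_comap, Submodule.mem_colon, SetLike.mem_coe, smul_eq_mul]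
  constructor
  · intro hg s hs
    have := hg (e.symm s) hs
    rwa [← map_mul] at this
  · intro hg r hr
    have := hg (e r) (by simpa using hr)
    rwa [map_mul, RingEquiv.symm_apply_apply] at this

/-- `idealSheafOf` respects colons (Noetherian affine base). [folklore] -/
theorem idealSheafOf_colon [IsNoetherianRing R] (I J : Ideal R) :
    colon (Hironaka2005.idealSheafOf I) (Hironaka2005.idealSheafOf J) = Hironaka2005.idealSheafOf (I.colon (J : Set R)) := by
  refine idealSheafOf_eq_of_ideal_top_eq ?_
  rw [ideal_colon, ideal_idealSheafOf_top, ideal_idealSheafOf_top]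
  exact (map_colon_of_ringEquiv (Scheme.ΓSpecIso (.of R)).symm.commRingCatIsoToRingEquiv I J).symm

/-- `idealSheafOf` respects suprema of families. [folklore] -/
theorem idealSheafOf_iSup {ι : Sort*} (J : ι → Ideal R) :
    Hironaka2005.idealSheafOf (⨆ i, J i) = ⨆ i, Hironaka2005.idealSheafOf (J i) := by
  change equivOfIsAffine.symm _ = ⨆ i, equivOfIsAffine.symm _
  rw [Ideal.map_iSup, map_iSup]

/-- **The strict transform along `Spec φ` of an `idealSheafOf`**: `strictTransformIdeal (Spec φ) (idealSheafOf I) (idealSheafOf J) = idealSheafOf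
(⨆ₙ (φJ : (φI)ⁿ))` (saturation of the total transform by the total transform of the centre). [folklore] -/
theorem strictTransformIdeal_specMap_idealSheafOf {A B : Type u} [CommRing A] [CommRing B] [IsNoetherianRing B] (φ : A →+* B) (I J : Ideal A) :
    strictTransformIdeal (Spec.map (CommRingCat.ofHom φ)) (Hironaka2005.idealSheafOf I) (Hironaka2005.idealSheafOf J) =
      Hironaka2005.idealSheafOf (⨆ n : ℕ, (J.map φ).colon (((I.map φ) ^ n : Ideal B) : Set B)) := by
  rw [strictTransformIdeal, Hironaka2005.comap_specMap_idealSheafOf, Hironaka2005.comap_specMap_idealSheafOf, idealSheafOf_iSup]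
  congr 1
  funext n
  rw [← idealSheafOf_pow, idealSheafOf_colon]

end Dict

/-! ## The coordinate frame and the coordinate-subspace centres of `𝔸ⁿ⁺¹_K` -/

section Affine

variable (n : ℕ) (K : Type u) [Field K]

/-- The reduced ideal sheaf `𝓘_Λ` of the coordinate subspace `C_Λ` is `idealSheafOf (xᵢ : i ∈ Λ)`. [folklore] -/
theorem 𝓘Λ_eq_idealSheafOf (Λ : Set (Fin (n + 1))) :
    AffineCoordBlowup.𝓘Λ n K Λ = Hironaka2005.idealSheafOf (AffineCoordBlowup.IΛ n K Λ) := by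
  refine idealSheafOf_eq_of_ideal_top_eq ?_
  change (AffineCoordBlowup.𝓘Λ n K Λ).ideal (AffinePointBlowup.Wtop n K) = _
  rw [AffineCoordBlowup.ideal_𝓘Λ_top, Ideal.map_span, ← Set.image_comp]
  rfl

end Affine

/-! ## The saturation `⨆ₙ (J : yⁿ)` and the coordinate blow-up chart: strict transform along `Spec (coordBlowupSubst)` = `coordStrictTransformIdeal` -/

section Saturation

variable {R : Type u} [CommRing R]

/-- Membership in the saturation `⨆ₙ (J : (y)ⁿ)`: `g` belongs to it iff `yᴺ g ∈ J` for some `N`. [folklore] -/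
theorem mem_iSup_colon_span_singleton_pow (J : Ideal R) (y g : R) :
    g ∈ (⨆ n : ℕ, J.colon ((Ideal.span {y} ^ n : Ideal R) : Set R)) ↔ ∃ N : ℕ, y ^ N * g ∈ J := by
  have hmono : Monotone fun n : ℕ => J.colon ((Ideal.span {y} ^ n : Ideal R) : Set R) := by
    intro a b hab
    refine Submodule.colon_mono le_rfl ?_
    exact_mod_cast Ideal.pow_le_pow_right hab
  rw [Submodule.mem_iSup_of_directed _ hmono.directed_le]
  refine exists_congr fun N => ?_
  rw [Ideal.span_singleton_pow, Submodule.mem_colon]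
  constructor
  · intro h
    have := h (y ^ N) (Ideal.mem_span_singleton_self _)
    rwa [smul_eq_mul, mul_comm] at this
  · intro h p hp
    obtain ⟨c, rfl⟩ := Ideal.mem_span_singleton'.mp hp
    rw [smul_eq_mul, show g * (c * y ^ N) = c * (y ^ N * g) by ring]
    exact Ideal.mul_mem_left _ _ h

variable (S : Type u) [CommRing S] {σ : Type v} (A : Set σ) (i₀ : σ)

/-- The saturation of the total transform by the exceptional equation IS the Literature strict transform ideal of the coordinate blow-up chart.
[cite: GortzWedhorn2020, Prop. 13.96 (2)] -/
theorem iSup_colon_eq_coordStrictTransformIdeal (hi₀ : i₀ ∈ A) (J : Ideal (MvPolynomial σ S)) :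
    (⨆ n : ℕ, (J.map (coordBlowupSubst S A i₀ : MvPolynomial σ S →+* MvPolynomial σ S)).colon
        ((((Ideal.span (X '' A)).map (coordBlowupSubst S A i₀ : MvPolynomial σ S →+* MvPolynomial σ S)) ^ n :
          Ideal (MvPolynomial σ S)) : Set (MvPolynomial σ S))) =
      coordStrictTransformIdeal S A i₀ J := by
  have hmap : (Ideal.span (X '' A)).map (coordBlowupSubst S A i₀ : MvPolynomial σ S →+* MvPolynomial σ S) =
      Ideal.span {(X i₀ : MvPolynomial σ S)} := map_coordBlowupSubst_span_eq S A i₀ hi₀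
  ext g
  rw [hmap, mem_iSup_colon_span_singleton_pow, mem_coordStrictTransformIdeal_iff]
  rfl

end Saturation

section Chart

variable (S : Type u) [CommRing S] [IsNoetherianRing S] {σ : Type u} [Fintype σ] (A : Set σ) (i₀ : σ)

/-- **The strict transform in the coordinate blow-up chart**: along `Spec (coordBlowupSubst S A i₀)`, the strict transform (w.r.t. the centre `(xᵢ : i ∈ A)`)
of `idealSheafOf J` is `idealSheafOf (coordStrictTransformIdeal S A i₀ J)`. [cite: GortzWedhorn2020, Prop. 13.96 (2)] -/
theorem strictTransformIdeal_specMap_coordBlowupSubst (hi₀ : i₀ ∈ A) (J : Ideal (MvPolynomial σ S)) :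
    strictTransformIdeal (Spec.map (CommRingCat.ofHom (coordBlowupSubst S A i₀ : MvPolynomial σ S →+* MvPolynomial σ S)))
        (Hironaka2005.idealSheafOf (Ideal.span (X '' A))) (Hironaka2005.idealSheafOf J) =
      Hironaka2005.idealSheafOf (coordStrictTransformIdeal S A i₀ J) := by
  rw [strictTransformIdeal_specMap_idealSheafOf, iSup_colon_eq_coordStrictTransformIdeal S A i₀ hi₀]

end Chart

/-! ## The closure lemma: `closure (V(f) ∖ V(y)) = V(f)` for a prime element `y ∤ f` of a UFD -/

section Closure



/-- In a UFD, a prime ideal containing `f ≠ 0` contains a prime FACTOR of `f`. [folklore] -/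
theorem exists_prime_dvd_mem_of_mem {R : Type u} [CommRing R] [UniqueFactorizationMonoid R] {p : Ideal R} (hp : p.IsPrime) {f : R} (hf : f ≠ 0) (hfp : f ∈ p) :
    ∃ π : R, Prime π ∧ π ∣ f ∧ π ∈ p := by
  induction f using UniqueFactorizationMonoid.induction_on_prime with
  | h₁ => exact absurd rfl hf
  | h₂ x hx => exact absurd (Ideal.eq_top_of_isUnit_mem _ hfp hx) hp.ne_top
  | h₃ a π ha hπ ih =>
    rcases hp.mem_or_mem hfp with h | h
    · exact ⟨π, hπ, dvd_mul_right π a, h⟩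
    · obtain ⟨ϖ, hϖ, hdvd, hmem⟩ := ih ha h
      exact ⟨ϖ, hϖ, hdvd.mul_left π, hmem⟩

/-- **The closure lemma**: for a prime element `y` not dividing `f`, the hypersurface `V(f)` has no component inside `V(y)`, so `V(f) ∖ V(y)` is dense in
`V(f)`: `closure (V(f) ∖ V(y)) = V(f)`. [folklore] -/
theorem closure_zeroLocus_diff_zeroLocus_of_not_dvd {R : Type u} [CommRing R] [IsDomain R] [UniqueFactorizationMonoid R] {f y : R} (hy : Prime y) (hyf : ¬ y ∣ f) :
    closure (PrimeSpectrum.zeroLocus {f} \ PrimeSpectrum.zeroLocus {y}) = PrimeSpectrum.zeroLocus ({f} : Set R) := by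
  have hf : f ≠ 0 := fun h => hyf (h ▸ dvd_zero y)
  refine le_antisymm ((PrimeSpectrum.isClosed_zeroLocus _).closure_subset_iff.mpr Set.sdiff_subset) ?_
  intro p hp
  rw [PrimeSpectrum.mem_zeroLocus, Set.singleton_subset_iff, SetLike.mem_coe] at hp
  obtain ⟨π, hπ, hπf, hπp⟩ := exists_prime_dvd_mem_of_mem p.2 hf hp
  -- the generic point `q = (π)` of the component `V(π) ∋ p` lies in `V(f) ∖ V(y)` and specialises to `p`
  let q : PrimeSpectrum R := ⟨Ideal.span {π}, (Ideal.span_singleton_prime hπ.ne_zero).mpr hπ⟩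
  have hq : q ∈ PrimeSpectrum.zeroLocus {f} \ PrimeSpectrum.zeroLocus {y} := by
    refine ⟨?_, ?_⟩
    · rw [PrimeSpectrum.mem_zeroLocus, Set.singleton_subset_iff, SetLike.mem_coe]
      exact Ideal.mem_span_singleton.mpr hπf
    · rw [PrimeSpectrum.mem_zeroLocus, Set.singleton_subset_iff, SetLike.mem_coe, Ideal.mem_span_singleton]
      intro h
      -- `π ∣ y` with `y` prime (irreducible) forces `π ~ y`, hence `y ∣ f`
      have hassoc : Associated π y := (hπ.irreducible.dvd_irreducible_iff_associated hy.irreducible).mp h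
      exact hyf (hassoc.symm.dvd.trans hπf)
  have hspec : p ∈ closure ({q} : Set (PrimeSpectrum R)) := by
    rw [← PrimeSpectrum.le_iff_mem_closure]
    change Ideal.span {π} ≤ p.asIdeal
    exact (Ideal.span_singleton_le_iff_mem _).mpr hπp
  exact closure_mono (Set.singleton_subset_iff.mpr hq) hspec


end Closure

end Summit.ResolutionOfSingularities.ResolutionOfSingularities.Cruxes.EquisingularLiftNat.Sections.ND

end
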